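import Summits.BirchSwinnertonDyer.BirchSwinnertonDyer.Theorems.ManinLocalTwoThreeTameUnitTwist
import Summits.BirchSwinnertonDyer.Rank1Residual.ManinAdditive.DegeneracyLoopLaws
import HarnessLib

/-!
# THEOREM U (es g22, MEMO-es §36.11), part 1/3: lower unipotents have zero period, the SIGN MOVE of Lemma G on plus parts,
# and the `ℤ/m` bookkeeping (cusp differences in `Λ_f`, conjugation, half-sum identity)

Summit `BirchSwinnertonDyer`, route `ManinLocalTwoThree` (cell bsd-f2-manin), crux C3 `ManinPrimeToThreeAtNine`
(stmt-BirchSwinnertonDyer-22968).  Sequel of `…TameUnitTwist` (E-es-87♭ PROVED); helper file for the f-level THEOREM U core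
(`…DegeneracyUnitTwist`) and its W-level squarefull consequences (`…DegeneracyUnitTwistSquarefull`).

* §1 `modularSymbol_div_lowerUnipotent` — `{∞, r/(NKr + 1)}_f = {∞, r}_f` (the lower unipotent `(1 0; NK 1) ∈ Γ₀(N)` fixes `0`,
  so its period vanishes; Manin's relation `modularSymbol_gamma0_smul_holds`); `modularSymbol_div_eq_conj_of_neg_add` — for
  `ℓ = −ℓ' + NKc`, `{∞, c/ℓ}_f = conj {∞, c/ℓ'}_f` (real coefficients); `exists_degeneracyLoop_prime_mod_three_eq_two` — at
  `3 ∣ N` every degeneracy loop `{∞, tb/ℓ} − {∞, b/ℓ}` (`ℓ` prime, `ℓ ∤ tN`, `ℓ ∤ b`) has the plus part of one at a prime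
  `ℓ' ≡ 2 (mod 3)` (Dirichlet in the class `−ℓ (mod tNb)`, `Nat.forall_exists_prime_gt_and_zmodEq`) — Lemma G of MEMO-es
  §36.11 (2) on plus parts.
* §2 `cuspDiff_mem_periodLattice` (`{∞, a/m} − {∞, 0} ∈ Λ_f` for a prime `m ∤ N`, Lemma A), `cuspDiff_neg_val_eq_conj`,
  `modularSymbol_natCast_div_eq_val`, `two_mul_twistedSymbolSum_eq_sum_plus` (half-sum identity for even `χ ≠ 1`).

HONEST FRAMING: elementary modular-symbol bookkeeping; nothing about C3, Manin's conjecture or BSD is proved.  No definitions,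
no named facts, no sorry.
-/

set_option linter.dupNamespace false
set_option autoImplicit false

noncomputable section

open scoped Classical MatrixGroups ModularForm ComplexConjugate

open CongruenceSubgroup Complex Literature.NumberTheory.EllipticCurves
  Literature.NumberTheory.EllipticCurves.ModularForms
  Summit.BirchSwinnertonDyer.Rank1Residual.ManinAdditive.Gamma1Lattice
  Summit.BirchSwinnertonDyer.Rank1Residual.ManinAdditive.KatoCurve

namespace Summit.BirchSwinnertonDyer.BirchSwinnertonDyer.Theorems.ManinLocalTwoThree

variable {N : ℕ} [NeZero N] (f : CuspForm (Gamma0 N) 2)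

/-! ### §1 Lower unipotents have zero period; the sign move of Lemma G -/

/-- **`{∞, r/(NKr + 1)}_f = {∞, r}_f`**: the lower unipotent `u = (1 0; NK 1) ∈ Γ₀(N)` fixes `0`, so its period
`{∞, u∞}_f = {∞, u0}_f − {∞, 0}_f` vanishes and Manin's relation gives `{∞, u r}_f = {∞, r}_f`. [cite: Manin1972, Prop. 1.4 / Thm. 1.6] -/
theorem modularSymbol_div_lowerUnipotent (r : ℚ) (K : ℤ) (hr : (N : ℚ) * K * r + 1 ≠ 0) :
    modularSymbol f (r / ((N : ℚ) * K * r + 1)) = modularSymbol f r := by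
  obtain ⟨δ, h00, h01, h10, h11⟩ : ∃ δ : Gamma0 N, ((δ : SL(2, ℤ)) 0 0 : ℤ) = 1 ∧
      ((δ : SL(2, ℤ)) 0 1 : ℤ) = 0 ∧ ((δ : SL(2, ℤ)) 1 0 : ℤ) = N * K ∧ ((δ : SL(2, ℤ)) 1 1 : ℤ) = 1 := by
    let M : Matrix (Fin 2) (Fin 2) ℤ := !![1, 0; (N : ℤ) * K, 1]
    have hdet : M.det = 1 := by
      rw [Matrix.det_fin_two_of]
      ring
    let δ₀ : SL(2, ℤ) := ⟨M, hdet⟩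
    have hmem : δ₀ ∈ Gamma0 N := by
      rw [Gamma0_mem]
      show ((((N : ℤ) * K : ℤ)) : ZMod N) = 0
      push_cast
      simp
    exact ⟨⟨δ₀, hmem⟩, rfl, rfl, rfl, rfl⟩
  have hδ : cuspSymbol f δ = 0 := by
    rw [cuspSymbol_eq_modularSymbol_div_sub f δ (by rw [h11]; exact one_ne_zero), h01, h11]
    simp
  have hne : (((δ : SL(2, ℤ)) 1 0 : ℤ) : ℚ) * r + (((δ : SL(2, ℤ)) 1 1 : ℤ) : ℚ) ≠ 0 := by
    rw [h10, h11]; push_cast; exact hr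
  have key := modularSymbol_gamma0_smul_holds f δ r hne
  rw [h00, h01, h10, h11, hδ, zero_add] at key
  push_cast at key
  rw [one_mul, add_zero] at key
  exact key

/-- **The sign move of Lemma G (plus parts).**  For `f` with real coefficients, primes (or any nonzero) `ℓ, ℓ'` with
`ℓ' = −ℓ + tNb·k`: `{∞, c/ℓ}_f = conj {∞, c/ℓ'}_f` for `c ∈ {b, tb}` — hence the degeneracy loops at `(ℓ, b)` and `(ℓ', b)`
are complex conjugate. -/
theorem modularSymbol_div_eq_conj_of_neg_add (hreal : ∀ n, (cuspCoeff f n).im = 0) {ℓ ℓ' : ℤ} (hℓ : ℓ ≠ 0)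
    (hℓ' : ℓ' ≠ 0) {c K : ℤ} (h : ℓ = -ℓ' + N * K * c) :
    modularSymbol f ((c : ℚ) / ℓ) = conj (modularSymbol f ((c : ℚ) / ℓ')) := by
  have hℓQ : (ℓ : ℚ) ≠ 0 := by exact_mod_cast hℓ
  have hℓ'Q : (ℓ' : ℚ) ≠ 0 := by exact_mod_cast hℓ'
  have hℓeq : (ℓ : ℚ) = -ℓ' + N * K * c := by exact_mod_cast h
  -- `r := −c/ℓ'`, `r/(NKr + 1) = c/ℓ`
  have e : (N : ℚ) * K * (-((c : ℚ) / ℓ')) + 1 = -(ℓ : ℚ) / ℓ' := by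
    rw [hℓeq]; field_simp; ring
  have hden : (N : ℚ) * K * (-((c : ℚ) / ℓ')) + 1 ≠ 0 := by
    rw [e]
    exact div_ne_zero (neg_ne_zero.mpr hℓQ) hℓ'Q
  have hq : -((c : ℚ) / ℓ') / ((N : ℚ) * K * (-((c : ℚ) / ℓ')) + 1) = (c : ℚ) / ℓ := by
    rw [e]
    field_simp
  rw [← hq, modularSymbol_div_lowerUnipotent f _ K hden, ← modularSymbol_neg_eq_conj_holds f hreal]

/-- **Every degeneracy loop at `3 ∣ N` has the plus part of one at a prime `ℓ' ≡ 2 (mod 3)`** (Dirichlet in the class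
`−ℓ (mod tNb)` when `ℓ ≡ 1 (mod 3)`; Lemma G of MEMO-es §36.11 on plus parts). -/
theorem exists_degeneracyLoop_prime_mod_three_eq_two (hreal : ∀ n, (cuspCoeff f n).im = 0) (h3 : 3 ∣ N) {t : ℕ}
    (ht : 0 < t) {ℓ b : ℕ} (hℓ : ℓ.Prime) (hℓt : ¬ ℓ ∣ t * N) (hℓb : ¬ ℓ ∣ b) :
    ∃ ℓ' : ℕ, ℓ'.Prime ∧ ¬ ℓ' ∣ t * N ∧ ¬ ℓ' ∣ b ∧ ℓ' % 3 = 2 ∧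
      (modularSymbol f (((t * b : ℕ) : ℚ) / ℓ') - modularSymbol f ((b : ℚ) / ℓ')) +
          conj (modularSymbol f (((t * b : ℕ) : ℚ) / ℓ') - modularSymbol f ((b : ℚ) / ℓ')) =
        (modularSymbol f (((t * b : ℕ) : ℚ) / ℓ) - modularSymbol f ((b : ℚ) / ℓ)) +
          conj (modularSymbol f (((t * b : ℕ) : ℚ) / ℓ) - modularSymbol f ((b : ℚ) / ℓ)) := by
  have hℓ3 : ¬ 3 ∣ ℓ := by
    intro h
    have : ℓ = 3 := ((Nat.prime_dvd_prime_iff_eq Nat.prime_three hℓ).mp h).symm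
    exact hℓt (this ▸ dvd_mul_of_dvd_right h3 t)
  by_cases hmod : ℓ % 3 = 2
  · exact ⟨ℓ, hℓ, hℓt, hℓb, hmod, rfl⟩
  · have hmod1 : ℓ % 3 = 1 := by omega
    have hb0 : b ≠ 0 := by rintro rfl; exact hℓb (dvd_zero ℓ)
    set q : ℕ := t * N * b with hq
    have hq0 : q ≠ 0 := mul_ne_zero (mul_ne_zero ht.ne' (NeZero.ne N)) hb0
    have hℓq : ¬ ℓ ∣ q := by
      intro h
      rcases (Nat.Prime.dvd_mul hℓ).mp h with h1 | h1
      · exact hℓt h1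
      · exact hℓb h1
    have hcop : IsCoprime (-(ℓ : ℤ)) (q : ℤ) :=
      (Nat.isCoprime_iff_coprime.mpr ((Nat.Prime.coprime_iff_not_dvd hℓ).mpr hℓq)).neg_left
    obtain ⟨ℓ', -, hℓ'p, hℓ'mod⟩ := Nat.forall_exists_prime_gt_and_zmodEq 0 hq0 hcop
    obtain ⟨k, hk⟩ : ∃ k : ℤ, (ℓ : ℤ) = -ℓ' + N * (t * k * b) := by
      obtain ⟨c, hc⟩ := Int.modEq_iff_dvd.mp hℓ'mod.symm
      refine ⟨c, ?_⟩
      rw [hq] at hc; push_cast at hc; linear_combination hc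
    -- `ℓ' ∤ q` (else `ℓ' ∣ ℓ`, so `ℓ' = ℓ ∣ q`)
    have hℓ'q : ¬ ℓ' ∣ q := by
      intro hd
      have hdZ : (ℓ' : ℤ) ∣ (q : ℤ) := Int.natCast_dvd_natCast.mpr hd
      have h1 : (ℓ' : ℤ) ∣ (ℓ : ℤ) := by
        have e : (ℓ : ℤ) = -ℓ' + k * (q : ℤ) := by rw [hk, hq]; push_cast; ring
        rw [e]
        exact dvd_add (dvd_neg.mpr dvd_rfl) (hdZ.mul_left k)
      have h2 : ℓ' ∣ ℓ := Int.natCast_dvd_natCast.mp h1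
      have : ℓ' = ℓ := (Nat.prime_dvd_prime_iff_eq hℓ'p hℓ).mp h2
      exact hℓq (this ▸ hd)
    refine ⟨ℓ', hℓ'p, fun h ↦ hℓ'q (h.mul_right b), fun h ↦ hℓ'q (h.mul_left _), ?_, ?_⟩
    · -- `ℓ' ≡ −ℓ ≡ 2 (mod 3)`
      have h3q : (3 : ℤ) ∣ (q : ℤ) := by
        rw [hq]; push_cast; exact (dvd_mul_of_dvd_right (by exact_mod_cast h3) _).mul_right _
      have hm3 : (ℓ' : ℤ) ≡ -ℓ [ZMOD 3] := hℓ'mod.of_dvd h3q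
      have := Int.emod_emod_of_dvd (ℓ' : ℤ) (show (3 : ℤ) ∣ 3 from dvd_rfl)
      have e1 : ((ℓ' % 3 : ℕ) : ℤ) = ((-(ℓ : ℤ)) % 3) := by push_cast; exact hm3
      omega
    · have hℓ0 : (ℓ : ℤ) ≠ 0 := by exact_mod_cast hℓ.ne_zero
      have hℓ'0 : (ℓ' : ℤ) ≠ 0 := by exact_mod_cast hℓ'p.ne_zero
      have e1 : modularSymbol f ((b : ℚ) / ℓ) = conj (modularSymbol f ((b : ℚ) / ℓ')) := by
        have := modularSymbol_div_eq_conj_of_neg_add f hreal hℓ0 hℓ'0 (c := b) (K := t * k)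
          (by rw [hk]; ring)
        simpa using this
      have e2 : modularSymbol f (((t * b : ℕ) : ℚ) / ℓ) = conj (modularSymbol f (((t * b : ℕ) : ℚ) / ℓ')) := by
        have := modularSymbol_div_eq_conj_of_neg_add f hreal hℓ0 hℓ'0 (c := (t * b : ℕ)) (K := k)
          (by rw [hk]; push_cast; ring)
        simpa using this
      rw [e1, e2, ← map_sub, Complex.conj_conj, add_comm]

/-! ### §2 Bookkeeping on `ℤ/m` (public versions of the `…TameUnitTwist` lemmas) -/

section PrimeModulus

variable {m : ℕ} [Fact m.Prime]

/-- **`{∞, a/m}_f − {∞, 0}_f ∈ Λ_f`** for a prime `m ∤ N` (Lemma A; representative `a.val ∈ [0, m)`). -/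
theorem cuspDiff_mem_periodLattice (hNm : IsCoprime (N : ℤ) m) (a : ZMod m) :
    modularSymbol f ((a.val : ℚ) / m) - modularSymbol f 0 ∈ periodLattice f := by
  by_cases ha : a = 0
  · subst ha; simp [ZMod.val_zero]
  · have hm : (m : ℤ) ≠ 0 := by exact_mod_cast (Fact.out : m.Prime).ne_zero
    have hval : 0 < a.val := Nat.pos_of_ne_zero ((ZMod.val_ne_zero a).mpr ha)
    have hcop : IsCoprime (a.val : ℤ) (m : ℤ) := by
      rw [Nat.isCoprime_iff_coprime]
      exact (Nat.coprime_of_lt_prime hval.ne' (ZMod.val_lt a) Fact.out).symm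
    obtain ⟨δ, -, -, hδ⟩ := exists_gamma0_modularSymbol_div f hm hcop hNm
    have e : ((a.val : ℤ) : ℚ) / ((m : ℤ) : ℚ) = (a.val : ℚ) / m := by push_cast; rfl
    rw [e] at hδ
    rw [hδ, add_sub_cancel_right]
    exact cuspSymbol_mem_periodLattice f δ

/-- `{∞, (−a)/m} − {∞, 0} = conj ({∞, a/m} − {∞, 0})` for `f` with real coefficients. -/
theorem cuspDiff_neg_val_eq_conj (hreal : ∀ n, (cuspCoeff f n).im = 0) (a : ZMod m) :
    modularSymbol f (((-a).val : ℚ) / m) - modularSymbol f 0 =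
      conj (modularSymbol f ((a.val : ℚ) / m) - modularSymbol f 0) := by
  have h0 : conj (modularSymbol f 0) = modularSymbol f 0 := by
    have := modularSymbol_neg_eq_conj_holds f hreal 0
    rw [neg_zero] at this
    exact this.symm
  by_cases ha : a = 0
  · subst ha
    simp [ZMod.val_zero]
  · have hval : (-a).val = m - a.val := by rw [ZMod.neg_val, if_neg ha]
    have hlt : a.val ≤ m := (ZMod.val_lt a).le
    have hmQ : (m : ℚ) ≠ 0 := by exact_mod_cast (Fact.out : m.Prime).ne_zero
    have e : (((-a).val : ℚ) / m) = -((a.val : ℚ) / m) + ((1 : ℤ) : ℚ) := by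
      rw [hval, Nat.cast_sub hlt]
      field_simp
      push_cast
      ring
    rw [e, modularSymbol_add_intCast_holds f, modularSymbol_neg_eq_conj_holds f hreal, map_sub, h0]

/-- `{∞, b/m}_f = {∞, (b mod m)/m}_f` for `b ∈ ℕ` (translation invariance). -/
theorem modularSymbol_natCast_div_eq_val (b : ℕ) :
    modularSymbol f ((b : ℚ) / m) = modularSymbol f ((((b : ZMod m)).val : ℚ) / m) := by
  have hmQ : (m : ℚ) ≠ 0 := by exact_mod_cast (Fact.out : m.Prime).ne_zero
  have hv : ((b : ZMod m)).val = b % m := ZMod.val_natCast (n := m) b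
  have hb : (b : ℚ) / m = ((((b : ZMod m)).val : ℚ) / m) + (((b / m : ℕ) : ℤ) : ℚ) := by
    have e1 : (b : ℚ) = ((b % m : ℕ) : ℚ) + (m : ℚ) * ((b / m : ℕ) : ℚ) := by
      have h : ((b % m + m * (b / m) : ℕ) : ℚ) = (b : ℚ) := congrArg Nat.cast (Nat.mod_add_div b m)
      rw [← h, Nat.cast_add, Nat.cast_mul]
    rw [hv, e1, Int.cast_natCast]
    field_simp
  rw [hb, modularSymbol_add_intCast_holds f]

/-- **Half-sum identity** (public form): for a non-trivial EVEN `χ` mod a prime `m` and `f` with real coefficients,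
`2·Σ_a χ(a){∞, a/m}_f = Σ_a χ(a)·(y_a + ȳ_a)`, `y_a = {∞, a/m}_f − {∞, 0}_f`. -/
theorem two_mul_twistedSymbolSum_eq_sum_plus (hreal : ∀ n, (cuspCoeff f n).im = 0) {χ : DirichletCharacter ℂ m}
    (hχ : χ ≠ 1) (hev : χ.Even) :
    2 * twistedSymbolSum f χ = ∑ a : ZMod m, χ a *
      ((modularSymbol f ((a.val : ℚ) / m) - modularSymbol f 0) +
        conj (modularSymbol f ((a.val : ℚ) / m) - modularSymbol f 0)) := by
  have hS : twistedSymbolSum f χ = ∑ a : ZMod m, χ a * (modularSymbol f ((a.val : ℚ) / m) - modularSymbol f 0) := by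
    have : ∑ a : ZMod m, χ a * (modularSymbol f ((a.val : ℚ) / m) - modularSymbol f 0) =
        ∑ a : ZMod m, χ a * modularSymbol f ((a.val : ℚ) / m) - (∑ a : ZMod m, χ a) * modularSymbol f 0 := by
      simp only [mul_sub, Finset.sum_sub_distrib, Finset.sum_mul]
    rw [this, χ.sum_eq_zero_of_ne_one hχ, zero_mul, sub_zero]
    rfl
  have hS' : twistedSymbolSum f χ =
      ∑ a : ZMod m, χ a * conj (modularSymbol f ((a.val : ℚ) / m) - modularSymbol f 0) := by
    rw [hS]
    refine Fintype.sum_equiv (Equiv.neg (ZMod m)) _ _ fun a ↦ ?_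
    rw [Equiv.neg_apply, hev.eval_neg, cuspDiff_neg_val_eq_conj f hreal, Complex.conj_conj]
  rw [two_mul]
  nth_rewrite 1 [hS]
  rw [hS', ← Finset.sum_add_distrib]
  refine Finset.sum_congr rfl fun a _ ↦ ?_
  ring

end PrimeModulus

end Summit.BirchSwinnertonDyer.BirchSwinnertonDyer.Theorems.ManinLocalTwoThree

end
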